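import Summits.Parity.GeneralizedHardyLittlewood.Theorems.LiouvilleShiftedTablesEngineToPairsDefs
import Summits.Parity.GeneralizedHardyLittlewood.Theses.LiouvilleShiftedTables
import Literature.NumberTheory.Sieve.DivisorPowerSums

/-!
# Stub `stub_TI2_of_X2` of line `Sketch` for the crux `EngineToPairs` (stmt-Parity-14659)

`TypeI2Dilated → TI2Budget`: the Type-I₂ budget for the family `shiftWeight h` over the coprime
moduli `moduliH h (x^ε₁)` is the crux X2 at `c := -h`, class `w := h`, almost verbatim:
`1[rsn ≡ h (q)] λ(toNat (rsn - h)) = shiftWeight h q (rsn)` (`x2_inner_eq`); the lower cut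
`x/2 < rsn` is the difference of the heights `y` and `min y (x/2)` (`inner_cut_eq_sub`); the
divisor weight is split as `τ^B |I| ≤ (t/2) τ^{2B} |I| + |I|/(2t)`, `t = (log x)^{-(A+κ)}`,
`κ = 2^{2B+1} + 2`, the first sum bounded TRIVIALLY (for `(q, h) = 1` the solutions of
`rsn ≡ h (q)` lie in ONE class mod `q`, so `|I_{q,r}| ≤ x (1 + log x)/(rq) + S`; then
`∑_{r ≤ x} τ(r)^{2B}/r ≪ (log x)^{2^{2B+1}}` from the tree), the second by X2 at `2A + κ`.
The returned exponent is `min ρ (1/4)` (`ρ` = X2's), so that `ε₁ + 1/2 + 3δ ≤ 1`.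
-/

noncomputable section

namespace Summit.Parity.GeneralizedHardyLittlewood.Theorems.EngineToPairs

open Finset Real
open Summit.Parity.GeneralizedHardyLittlewood.Theses.LiouvilleShiftedTables

namespace TI2OfX2

/-- `#{n ∈ [1, N] : n ≡ a (mod q)} ≤ N / q + 1` (`n ↦ n / q` is injective on a class).
[folklore] -/
theorem card_Icc_filter_modEq_le (N q a : ℕ) :
    ((Icc 1 N).filter (fun n : ℕ => n ≡ a [MOD q])).card ≤ N / q + 1 := by
  rw [← Finset.card_range (N / q + 1)]
  refine Finset.card_le_card_of_injOn (fun n => n / q) (fun n hn => ?_) fun n hn n' hn' h => ?_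
  · rw [Finset.coe_filter] at hn
    rw [Finset.coe_range, Set.mem_Iio, Nat.lt_add_one_iff]
    exact Nat.div_le_div_right (Finset.mem_Icc.1 hn.1).2
  · rw [Finset.coe_filter] at hn hn'
    have hm : n % q = n' % q := hn.2.trans hn'.2.symm
    simp only at h
    calc n = q * (n / q) + n % q := (Nat.div_add_mod n q).symm
      _ = q * (n' / q) + n' % q := by rw [h, hm]
      _ = n' := Nat.div_add_mod n' q

/-- For `(q, h) = 1` the solutions `n ∈ [1, N]` of `m n ≡ h (mod q)` lie in a single class modulo
`q` (a solution forces `(m, q) = 1`), so there are at most `N / q + 1` of them. [folklore] -/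
theorem card_Icc_filter_mul_modEq_le {q h : ℕ} (hqh : Nat.Coprime q h) (m N : ℕ) :
    ((Icc 1 N).filter (fun n : ℕ => m * n ≡ h [MOD q])).card ≤ N / q + 1 := by
  rcases ((Icc 1 N).filter (fun n : ℕ => m * n ≡ h [MOD q])).eq_empty_or_nonempty with
    h0 | ⟨n₀, hn₀⟩
  · rw [h0, Finset.card_empty]; exact Nat.zero_le _
  · have hn₀' : m * n₀ ≡ h [MOD q] := (Finset.mem_filter.1 hn₀).2
    have hcop : Nat.Coprime m q := by
      have h2 : Nat.Coprime (m * n₀) q := by rw [Nat.Coprime, hn₀'.gcd_eq]; exact hqh.symm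
      exact h2.coprime_mul_right
    calc ((Icc 1 N).filter (fun n : ℕ => m * n ≡ h [MOD q])).card
        ≤ ((Icc 1 N).filter (fun n : ℕ => n ≡ n₀ [MOD q])).card := by
          refine Finset.card_le_card fun n hn => ?_
          rw [Finset.mem_filter] at hn ⊢
          exact ⟨hn.1, Nat.ModEq.cancel_left_of_coprime hcop.symm (hn.2.trans hn₀'.symm)⟩
      _ ≤ N / q + 1 := card_Icc_filter_modEq_le N q n₀

/-- The trivial bound for the class weight along multiples of `m`:
`∑_{n ≤ N} |shiftWeight h q (m n)| ≤ N/q + 1` for `(q, h) = 1`. [folklore] -/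
theorem sum_abs_shiftWeight_le {q h : ℕ} (hqh : Nat.Coprime q h) (m N : ℕ) :
    ∑ n ∈ Icc 1 N, |shiftWeight h q (m * n)| ≤ (N : ℝ) / q + 1 := by
  calc ∑ n ∈ Icc 1 N, |shiftWeight h q (m * n)|
      ≤ ∑ n ∈ Icc 1 N, (if m * n ≡ h [MOD q] then (1 : ℝ) else 0) := by
        refine Finset.sum_le_sum fun n _ => ?_
        by_cases hc : m * n ≡ h [MOD q]
        · rw [if_pos hc]; exact abs_shiftWeight_le_one h q (m * n)
        · simp [shiftWeight, hc]
    _ = (((Icc 1 N).filter (fun n : ℕ => m * n ≡ h [MOD q])).card : ℝ) := by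
        rw [Finset.natCast_card_filter]
    _ ≤ ((N / q + 1 : ℕ) : ℝ) := by exact_mod_cast card_Icc_filter_mul_modEq_le hqh m N
    _ ≤ (N : ℝ) / q + 1 := by push_cast; gcongr; exact Nat.cast_div_le

/-- Harmonic bound: `∑_{s ≤ S} 1/s ≤ 1 + log x` for `0 ≤ S ≤ x`, `1 ≤ x`. [folklore] -/
theorem sum_inv_le_one_add_log {S x : ℝ} (hS0 : 0 ≤ S) (hSx : S ≤ x) (hx : 1 ≤ x) :
    ∑ s ∈ Icc 1 ⌊S⌋₊, (s : ℝ)⁻¹ ≤ 1 + Real.log x := by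
  have h := harmonic_le_one_add_log ⌊S⌋₊
  rw [harmonic_eq_sum_Icc, Rat.cast_sum] at h
  push_cast at h
  refine h.trans ?_
  rcases Nat.eq_zero_or_pos ⌊S⌋₊ with h0 | hpos
  · rw [h0, Nat.cast_zero, Real.log_zero]; linarith [Real.log_nonneg hx]
  · have h1 : (0 : ℝ) < ⌊S⌋₊ := by exact_mod_cast hpos
    linarith [Real.log_le_log h1 ((Nat.floor_le hS0).trans hSx)]

/-- **Trivial bound.** For `(q, h) = 1`, `r ≥ 1`, `0 ≤ y ≤ x`, `0 ≤ S ≤ x` and any sub-ranges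
`T s ⊆ [1, y/(sr)]`: `|∑_{s ≤ S} ∑_{n ∈ T s} shiftWeight h q (rsn)| ≤ x (1 + log x)/(rq) + S`
(class count `≤ y/(srq) + 1` for each `s`, then the harmonic sum). [folklore] -/
theorem abs_inner_le_trivial {q h r : ℕ} (hqh : Nat.Coprime q h) (hq : 1 ≤ q) (hr : 1 ≤ r)
    {x y S : ℝ} (hx : 1 ≤ x) (hy0 : 0 ≤ y) (hyx : y ≤ x) (hS0 : 0 ≤ S) (hSx : S ≤ x)
    (T : ℕ → Finset ℕ) (hT : ∀ s, T s ⊆ Icc 1 ⌊y / (s * r)⌋₊) :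
    |∑ s ∈ Icc 1 ⌊S⌋₊, ∑ n ∈ T s, shiftWeight h q (r * s * n)| ≤
      x * (1 + Real.log x) / (r * q) + S := by
  have hq0 : (0 : ℝ) < q := by exact_mod_cast hq
  have hr0 : (0 : ℝ) < r := by exact_mod_cast hr
  have hx0 : (0 : ℝ) ≤ x := by linarith
  calc |∑ s ∈ Icc 1 ⌊S⌋₊, ∑ n ∈ T s, shiftWeight h q (r * s * n)|
      ≤ ∑ s ∈ Icc 1 ⌊S⌋₊, |∑ n ∈ T s, shiftWeight h q (r * s * n)| :=
        Finset.abs_sum_le_sum_abs _ _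
    _ ≤ ∑ s ∈ Icc 1 ⌊S⌋₊, (x / (r * q) * (s : ℝ)⁻¹ + 1) := by
        refine Finset.sum_le_sum fun s hs => ?_
        have hs0 : (0 : ℝ) < s := by exact_mod_cast (Finset.mem_Icc.1 hs).1
        calc |∑ n ∈ T s, shiftWeight h q (r * s * n)|
            ≤ ∑ n ∈ T s, |shiftWeight h q (r * s * n)| := Finset.abs_sum_le_sum_abs _ _
          _ ≤ ∑ n ∈ Icc 1 ⌊y / (s * r)⌋₊, |shiftWeight h q (r * s * n)| :=
              Finset.sum_le_sum_of_subset_of_nonneg (hT s) fun _ _ _ => abs_nonneg _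
          _ ≤ (⌊y / (s * r)⌋₊ : ℝ) / q + 1 := sum_abs_shiftWeight_le hqh (r * s) _
          _ ≤ y / (s * r) / q + 1 := by gcongr; exact Nat.floor_le (by positivity)
          _ ≤ x / (s * r) / q + 1 := by gcongr
          _ = x / (r * q) * (s : ℝ)⁻¹ + 1 := by field_simp
    _ = x / (r * q) * ∑ s ∈ Icc 1 ⌊S⌋₊, (s : ℝ)⁻¹ + (⌊S⌋₊ : ℝ) := by
        rw [Finset.sum_add_distrib, ← Finset.mul_sum, Finset.sum_const, Nat.card_Icc,
          nsmul_eq_mul, mul_one, Nat.add_sub_cancel]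
    _ ≤ x / (r * q) * (1 + Real.log x) + S := by
        gcongr
        · exact sum_inv_le_one_add_log hS0 hSx hx
        · exact Nat.floor_le hS0
    _ = x * (1 + Real.log x) / (r * q) + S := by ring

/-- For `1 ≤ n ≤ y/(sr)` (`0 ≤ y ≤ x`): `x/2 < rsn ↔ n > ⌊min y (x/2)/(sr)⌋`. [folklore] -/
theorem filter_lower_cut_eq {r s : ℕ} (hr : 1 ≤ r) (hs : 1 ≤ s) {x y : ℝ} (hy0 : 0 ≤ y)
    (hyx : y ≤ x) :
    (Icc 1 ⌊y / (s * r)⌋₊).filter (fun n : ℕ => x / 2 < (r : ℝ) * s * n) =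
      Icc 1 ⌊y / (s * r)⌋₊ \ Icc 1 ⌊min y (x / 2) / (s * r)⌋₊ := by
  have hr0 : (0 : ℝ) < r := by exact_mod_cast hr
  have hs0 : (0 : ℝ) < s := by exact_mod_cast hs
  have hsr : (0 : ℝ) < (s : ℝ) * r := by positivity
  have hx0 : 0 ≤ x := hy0.trans hyx
  have hy' : 0 ≤ min y (x / 2) := le_min hy0 (by linarith)
  ext n
  simp only [Finset.mem_filter, Finset.mem_sdiff, Finset.mem_Icc]
  have e : (r : ℝ) * s * n = n * (s * r) := by ring
  constructor
  · rintro ⟨⟨h1, hN⟩, hP⟩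
    refine ⟨⟨h1, hN⟩, fun ⟨_, hN'⟩ => ?_⟩
    have h2 : (n : ℝ) ≤ min y (x / 2) / (s * r) := (Nat.le_floor_iff (by positivity)).1 hN'
    rw [le_div_iff₀ hsr] at h2
    linarith [min_le_right y (x / 2)]
  · rintro ⟨⟨h1, hN⟩, hnot⟩
    refine ⟨⟨h1, hN⟩, ?_⟩
    have hlt : ⌊min y (x / 2) / (s * r)⌋₊ < n := by
      by_contra hle
      push Not at hle
      exact hnot ⟨h1, hle⟩
    rw [Nat.floor_lt (by positivity), div_lt_iff₀ hsr] at hlt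
    rcases min_cases y (x / 2) with ⟨hm, _⟩ | ⟨hm, _⟩
    · rw [hm] at hlt
      have h2 : (n : ℝ) ≤ y / (s * r) := (Nat.le_floor_iff (by positivity)).1 hN
      rw [le_div_iff₀ hsr] at h2
      linarith
    · rw [hm] at hlt
      linarith

/-- The inner Type-I₂ sum with the lower cut is the difference of the two cut-free sums at the
heights `y` and `min y (x/2)`. [folklore] -/
theorem inner_cut_eq_sub {r : ℕ} (hr : 1 ≤ r) {x y : ℝ} (hy0 : 0 ≤ y) (hyx : y ≤ x) (h q : ℕ)
    (S : ℝ) :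
    ∑ s ∈ Icc 1 ⌊S⌋₊, ∑ n ∈ (Icc 1 ⌊y / (s * r)⌋₊).filter
        (fun n : ℕ => x / 2 < (r : ℝ) * s * n), shiftWeight h q (r * s * n) =
      ∑ s ∈ Icc 1 ⌊S⌋₊, ∑ n ∈ Icc 1 ⌊y / (s * r)⌋₊, shiftWeight h q (r * s * n) -
        ∑ s ∈ Icc 1 ⌊S⌋₊, ∑ n ∈ Icc 1 ⌊min y (x / 2) / (s * r)⌋₊,
          shiftWeight h q (r * s * n) := by
  rw [← Finset.sum_sub_distrib]
  refine Finset.sum_congr rfl fun s hs => ?_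
  have hs1 : 1 ≤ s := (Finset.mem_Icc.1 hs).1
  have hr0 : (0 : ℝ) < r := by exact_mod_cast hr
  have hs0 : (0 : ℝ) < s := by exact_mod_cast hs1
  rw [filter_lower_cut_eq hr hs1 hy0 hyx, Finset.sum_sdiff_eq_sub (Finset.Icc_subset_Icc le_rfl
    (Nat.floor_mono (div_le_div_of_nonneg_right (min_le_left _ _) (by positivity))))]

/-- X2's inner class-filtered summand at `c = -h`, `w = h` IS the class weight:
`∑_{n ≤ N, rsn ≡ h (q)} λ(toNat (rsn - h)) = ∑_{n ≤ N} shiftWeight h q (rsn)`. [this line] -/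
theorem x2_inner_eq (h q r s N : ℕ) :
    ∑ n ∈ (Icc 1 N).filter (fun n : ℕ => r * s * n ≡ h [MOD q]),
        (ArithmeticFunction.liouville (Int.toNat ((r : ℤ) * s * n + -(h : ℤ))) : ℝ) =
      ∑ n ∈ Icc 1 N, shiftWeight h q (r * s * n) := by
  rw [Finset.sum_filter]
  refine Finset.sum_congr rfl fun n _ => ?_
  have e : Int.toNat ((r : ℤ) * s * n + -(h : ℤ)) = r * s * n - h := by
    have e1 : (r : ℤ) * s * n + -(h : ℤ) = ((r * s * n : ℕ) : ℤ) - (h : ℕ) := by push_cast; ring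
    rw [e1, Int.toNat_sub]
  unfold shiftWeight
  rw [e]

/-- `τ a ≤ (t/2) τ² a + a/(2t)` for `a ≥ 0`, `t > 0` (from `(tτ - 1)² ≥ 0`). [folklore] -/
theorem weight_split {τ a t : ℝ} (ha : 0 ≤ a) (ht : 0 < t) :
    τ * a ≤ t / 2 * (τ ^ 2 * a) + 1 / (2 * t) * a := by
  have h1 : τ ≤ t / 2 * τ ^ 2 + 1 / (2 * t) := by
    have h2 : t / 2 * τ ^ 2 + 1 / (2 * t) - τ = (t * τ - 1) ^ 2 / (2 * t) := by
      field_simp; ring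
    have h3 : 0 ≤ (t * τ - 1) ^ 2 / (2 * t) := by positivity
    linarith
  calc τ * a ≤ (t / 2 * τ ^ 2 + 1 / (2 * t)) * a := mul_le_mul_of_nonneg_right h1 ha
    _ = t / 2 * (τ ^ 2 * a) + 1 / (2 * t) * a := by ring

/-- **The `τ^{2B}`-weighted sum, trivially.** If `|I q r| ≤ x (1 + log x)/(rq) + S` for
`q ∈ moduliH h Q`, `r ≤ R` (`1 ≤ R ≤ x`, `0 ≤ S`, `0 ≤ Q ≤ x`, `Q S R ≤ x`, `log x ≥ 1`) and
`∑_{n ≤ x} τ(n)^{2B}/n ≤ C₁ (log x)^{2^{2B+1}}`, then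
`∑_q ∑_r τ(r)^{2B} |I q r| ≤ 5 C₁ x (log x)^{κ}`, `κ = 2^{2B+1} + 2`. [this line] -/
theorem first_sum_le {h B : ℕ} {x R S Q C₁ : ℝ} {I : ℕ → ℕ → ℝ}
    (hdiv : ∑ n ∈ Icc 1 ⌊x⌋₊, ((ArithmeticFunction.sigma 0 n : ℕ) : ℝ) ^ (2 * B) / n ≤
      C₁ * Real.log x ^ (2 ^ (2 * B + 1)))
    (hI : ∀ q ∈ moduliH h Q, ∀ r ∈ Icc 1 ⌊R⌋₊, |I q r| ≤ x * (1 + Real.log x) / (r * q) + S)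
    (hx : 1 ≤ x) (hL : 1 ≤ Real.log x) (hR1 : 1 ≤ R) (hRx : R ≤ x) (hS0 : 0 ≤ S)
    (hQ0 : 0 ≤ Q) (hQx : Q ≤ x) (hQSR : Q * (S * R) ≤ x) :
    ∑ q ∈ moduliH h Q, ∑ r ∈ Icc 1 ⌊R⌋₊, tauPow B r ^ 2 * |I q r| ≤
      5 * C₁ * x * Real.log x ^ (2 ^ (2 * B + 1) + 2) := by
  set L := Real.log x with hLdef
  set c₁ : ℕ := 2 ^ (2 * B + 1) with hc₁
  have hx0 : 0 ≤ x := by linarith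
  -- divisor moments over `r ≤ R` (`tauPow B n ^ 2 = τ(n)^{2B}`)
  have htau : ∀ n : ℕ, tauPow B n ^ 2 = ((ArithmeticFunction.sigma 0 n : ℕ) : ℝ) ^ (2 * B) := by
    intro n
    rw [ArithmeticFunction.sigma_zero_apply, tauPow, ← pow_mul']
  have hsub : Icc 1 ⌊R⌋₊ ⊆ Icc 1 ⌊x⌋₊ := Finset.Icc_subset_Icc le_rfl (Nat.floor_mono hRx)
  have hd1 : ∑ r ∈ Icc 1 ⌊R⌋₊, tauPow B r ^ 2 / r ≤ C₁ * L ^ c₁ := by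
    refine le_trans (Finset.sum_le_sum_of_subset_of_nonneg hsub fun r _ _ => by positivity) ?_
    simpa only [htau] using hdiv
  have hC₁L : 0 ≤ C₁ * L ^ c₁ := le_trans (Finset.sum_nonneg fun r _ => by positivity) hd1
  have hd2 : ∑ r ∈ Icc 1 ⌊R⌋₊, tauPow B r ^ 2 ≤ R * (C₁ * L ^ c₁) := by
    calc ∑ r ∈ Icc 1 ⌊R⌋₊, tauPow B r ^ 2
        ≤ ∑ r ∈ Icc 1 ⌊R⌋₊, R * (tauPow B r ^ 2 / r) := by
          refine Finset.sum_le_sum fun r hr => ?_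
          have hr0 : (0 : ℝ) < r := by exact_mod_cast (Finset.mem_Icc.1 hr).1
          have hrR : (r : ℝ) ≤ R :=
            le_trans (by exact_mod_cast (Finset.mem_Icc.1 hr).2) (Nat.floor_le (by linarith))
          rw [mul_div_assoc', le_div_iff₀ hr0, mul_comm R]
          exact mul_le_mul_of_nonneg_left hrR (by positivity)
      _ = R * ∑ r ∈ Icc 1 ⌊R⌋₊, tauPow B r ^ 2 / r := (Finset.mul_sum _ _ _).symm
      _ ≤ R * (C₁ * L ^ c₁) := mul_le_mul_of_nonneg_left hd1 (by linarith)
  -- the per-`q` bound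
  have hq_sum : ∀ q ∈ moduliH h Q, ∑ r ∈ Icc 1 ⌊R⌋₊, tauPow B r ^ 2 * |I q r| ≤
      x * (1 + L) * (C₁ * L ^ c₁) * (q : ℝ)⁻¹ + S * (R * (C₁ * L ^ c₁)) := by
    intro q hq
    have hq0 : (0 : ℝ) < q := by exact_mod_cast (mem_moduliH.1 hq).1.1
    calc ∑ r ∈ Icc 1 ⌊R⌋₊, tauPow B r ^ 2 * |I q r|
        ≤ ∑ r ∈ Icc 1 ⌊R⌋₊, tauPow B r ^ 2 * (x * (1 + L) / (r * q) + S) :=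
          Finset.sum_le_sum fun r hr => mul_le_mul_of_nonneg_left (hI q hq r hr) (by positivity)
      _ = x * (1 + L) * (q : ℝ)⁻¹ * ∑ r ∈ Icc 1 ⌊R⌋₊, tauPow B r ^ 2 / r +
            S * ∑ r ∈ Icc 1 ⌊R⌋₊, tauPow B r ^ 2 := by
          rw [Finset.mul_sum, Finset.mul_sum, ← Finset.sum_add_distrib]
          refine Finset.sum_congr rfl fun r hr => ?_
          have hr0 : (0 : ℝ) < r := by exact_mod_cast (Finset.mem_Icc.1 hr).1
          field_simp
      _ ≤ x * (1 + L) * (q : ℝ)⁻¹ * (C₁ * L ^ c₁) + S * (R * (C₁ * L ^ c₁)) := by gcongr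
      _ = x * (1 + L) * (C₁ * L ^ c₁) * (q : ℝ)⁻¹ + S * (R * (C₁ * L ^ c₁)) := by ring
  -- the moduli: harmonic sum and cardinality
  have hQsub : moduliH h Q ⊆ Icc 1 ⌊Q⌋₊ := by
    unfold moduliH; exact Finset.filter_subset _ _
  have hharmQ : ∑ q ∈ moduliH h Q, (q : ℝ)⁻¹ ≤ 1 + L :=
    le_trans (Finset.sum_le_sum_of_subset_of_nonneg hQsub fun q _ _ => by positivity)
      (sum_inv_le_one_add_log hQ0 hQx hx)
  have hcardQ : ((moduliH h Q).card : ℝ) ≤ Q := by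
    calc ((moduliH h Q).card : ℝ) ≤ ((Icc 1 ⌊Q⌋₊).card : ℝ) := by
          exact_mod_cast Finset.card_le_card hQsub
      _ = ⌊Q⌋₊ := by rw [Nat.card_Icc, Nat.add_sub_cancel]
      _ ≤ Q := Nat.floor_le hQ0
  have hL0 : 0 ≤ L := by linarith
  calc ∑ q ∈ moduliH h Q, ∑ r ∈ Icc 1 ⌊R⌋₊, tauPow B r ^ 2 * |I q r|
      ≤ ∑ q ∈ moduliH h Q, (x * (1 + L) * (C₁ * L ^ c₁) * (q : ℝ)⁻¹ + S * (R * (C₁ * L ^ c₁))) :=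
        Finset.sum_le_sum hq_sum
    _ = x * (1 + L) * (C₁ * L ^ c₁) * ∑ q ∈ moduliH h Q, (q : ℝ)⁻¹ +
          (moduliH h Q).card * (S * (R * (C₁ * L ^ c₁))) := by
        rw [Finset.sum_add_distrib, ← Finset.mul_sum, Finset.sum_const, nsmul_eq_mul]
    _ ≤ x * (1 + L) * (C₁ * L ^ c₁) * (1 + L) + Q * (S * (R * (C₁ * L ^ c₁))) := by gcongr
    _ = C₁ * L ^ c₁ * (x * (1 + L) ^ 2 + Q * (S * R)) := by ring
    _ ≤ C₁ * L ^ c₁ * (x * (2 * L) ^ 2 + x) := by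
        gcongr
        linarith
    _ = C₁ * L ^ c₁ * x * (4 * L ^ 2 + 1) := by ring
    _ ≤ C₁ * L ^ c₁ * x * (5 * L ^ 2) :=
        mul_le_mul_of_nonneg_left (by nlinarith) (by positivity)
    _ = 5 * C₁ * x * L ^ (c₁ + 2) := by ring

end TI2OfX2

open TI2OfX2

/-- **Stub S7: the Type-I₂ budget from `TypeI2Dilated` (X2) at `c = -h`, `w = h`** (exponent
`min ρ (1/4)`, `ρ` = X2's; lower cut by differencing the height; `τ(r)^B` split as
`τ^B |I| ≤ (t/2) τ^{2B} |I| + |I|/(2t)`, `t = (log x)^{-(A+κ)}`: trivial bound + X2 at `2A + κ`).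
[this line] -/
theorem stub_TI2_of_X2 : TypeI2Dilated → TI2Budget := by
  intro hX2 h hh
  obtain ⟨ρ, hρ, hXA⟩ := hX2 (-(h : ℤ)) (by omega)
  refine ⟨min ρ (1 / 4), lt_min hρ (by norm_num), ?_⟩
  intro δ hδ h3δ ε₁ hε₁ hε₁ρ B A hA
  obtain ⟨κ, hκ⟩ : ∃ κ : ℕ, κ = 2 ^ (2 * B + 1) + 2 := ⟨_, rfl⟩
  obtain ⟨C₁, -, hdiv⟩ :=
    Literature.NumberTheory.Sieve.exists_sum_sigma_zero_pow_div_le_real (2 * B)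
  obtain ⟨CX, x₀, hX⟩ := hXA (2 * A + κ) (by positivity)
  refine ⟨5 * C₁ / 2 + CX, max x₀ (Real.exp 2), ?_⟩
  intro x hx R S y hR1 hRδ hS0 hSR hy0 hyx
  obtain ⟨hx₀, hxe⟩ := max_le_iff.1 hx
  have hx3 : (3 : ℝ) ≤ x := le_trans (by linarith [Real.add_one_le_exp (2 : ℝ)]) hxe
  have hx1 : (1 : ℝ) ≤ x := by linarith
  have hx0 : (0 : ℝ) < x := by linarith
  have hL2 : (2 : ℝ) ≤ Real.log x := by rw [Real.le_log_iff_exp_le hx0]; exact hxe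
  have hL1 : 1 ≤ Real.log x := by linarith
  have hL0 : 0 < Real.log x := by linarith
  -- exponents
  have hρ' : min ρ (1 / 4) ≤ ρ := min_le_left _ _
  have hρ4 : min ρ (1 / 4) ≤ 1 / 4 := min_le_right _ _
  have hRρ : R ≤ x ^ ρ := hRδ.trans (Real.rpow_le_rpow_of_exponent_le hx1 (by linarith))
  have hSRρ : S * R ≤ x ^ (1 / 2 + ρ) :=
    hSR.trans (Real.rpow_le_rpow_of_exponent_le hx1 (by linarith))
  have hxpow : ∀ e : ℝ, e ≤ 1 → x ^ e ≤ x := fun e he => by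
    simpa only [Real.rpow_one] using Real.rpow_le_rpow_of_exponent_le hx1 he
  have hRx : R ≤ x := hRδ.trans (hxpow δ (by linarith))
  have hSx : S ≤ x := by
    calc S = S * 1 := (mul_one S).symm
      _ ≤ S * R := mul_le_mul_of_nonneg_left hR1 hS0
      _ ≤ x := hSR.trans (hxpow _ (by linarith))
  have hQ0 : 0 ≤ x ^ ε₁ := by positivity
  have hQx : x ^ ε₁ ≤ x := hxpow ε₁ (by linarith)
  have hQSR : x ^ ε₁ * (S * R) ≤ x := by
    calc x ^ ε₁ * (S * R) ≤ x ^ ε₁ * x ^ (1 / 2 + 3 * δ) := mul_le_mul_of_nonneg_left hSR hQ0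
      _ = x ^ (ε₁ + (1 / 2 + 3 * δ)) := (Real.rpow_add hx0 _ _).symm
      _ ≤ x := hxpow _ (by linarith)
  set y' := min y (x / 2) with hy'def
  have hy'0 : 0 ≤ y' := le_min hy0 (by linarith)
  have hy'x : y' ≤ x := (min_le_left _ _).trans hyx
  -- abbreviations: the cut inner sum `I q r` and the cut-free inner sums `J z q r`
  obtain ⟨I, hI⟩ : ∃ I : ℕ → ℕ → ℝ, ∀ q r, I q r = ∑ s ∈ Icc 1 ⌊S⌋₊,
      ∑ n ∈ (Icc 1 ⌊y / (s * r)⌋₊).filter (fun n : ℕ => x / 2 < (r : ℝ) * s * n),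
        shiftWeight h q (r * s * n) := ⟨_, fun _ _ => rfl⟩
  obtain ⟨J, hJ⟩ : ∃ J : ℝ → ℕ → ℕ → ℝ, ∀ z q r, J z q r = ∑ s ∈ Icc 1 ⌊S⌋₊,
      ∑ n ∈ Icc 1 ⌊z / (s * r)⌋₊, shiftWeight h q (r * s * n) := ⟨_, fun _ _ _ => rfl⟩
  simp only [← hI]
  have hXy := hX x hx₀ h R S y hR1 hRρ hS0 hSRρ hy0 hyx
  have hXy' := hX x hx₀ h R S y' hR1 hRρ hS0 hSRρ hy'0 hy'x
  simp only [x2_inner_eq, ← hJ] at hXy hXy'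
  have hQs : moduliH h (x ^ ε₁) ⊆ Icc 1 ⌊x ^ ρ⌋₊ := by
    unfold moduliH
    exact (Finset.filter_subset _ _).trans (Finset.Icc_subset_Icc le_rfl
      (Nat.floor_mono (Real.rpow_le_rpow_of_exponent_le hx1 (hε₁ρ.trans hρ'))))
  have hIJ : ∀ q, ∀ r ∈ Icc 1 ⌊R⌋₊, |I q r| ≤ |J y q r| + |J y' q r| := by
    intro q r hr
    rw [hI, hJ, hJ, inner_cut_eq_sub (Finset.mem_Icc.1 hr).1 hy0 hyx]
    exact abs_sub _ _
  have hF2 : ∑ q ∈ moduliH h (x ^ ε₁), ∑ r ∈ Icc 1 ⌊R⌋₊, |I q r| ≤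
      2 * (CX * x / Real.log x ^ (2 * A + κ)) := by
    calc ∑ q ∈ moduliH h (x ^ ε₁), ∑ r ∈ Icc 1 ⌊R⌋₊, |I q r|
        ≤ ∑ q ∈ moduliH h (x ^ ε₁), ∑ r ∈ Icc 1 ⌊R⌋₊, (|J y q r| + |J y' q r|) :=
          Finset.sum_le_sum fun q _ => Finset.sum_le_sum fun r hr => hIJ q r hr
      _ = ∑ q ∈ moduliH h (x ^ ε₁), ∑ r ∈ Icc 1 ⌊R⌋₊, |J y q r| +
            ∑ q ∈ moduliH h (x ^ ε₁), ∑ r ∈ Icc 1 ⌊R⌋₊, |J y' q r| := by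
          simp only [Finset.sum_add_distrib]
      _ ≤ ∑ q ∈ Icc 1 ⌊x ^ ρ⌋₊, ∑ r ∈ Icc 1 ⌊R⌋₊, |J y q r| +
            ∑ q ∈ Icc 1 ⌊x ^ ρ⌋₊, ∑ r ∈ Icc 1 ⌊R⌋₊, |J y' q r| := by gcongr
      _ ≤ CX * x / Real.log x ^ (2 * A + κ) + CX * x / Real.log x ^ (2 * A + κ) :=
          add_le_add hXy hXy'
      _ = 2 * (CX * x / Real.log x ^ (2 * A + κ)) := by ring
  -- the `τ^{2B}`-weighted sum: trivially
  have hItriv : ∀ q ∈ moduliH h (x ^ ε₁), ∀ r ∈ Icc 1 ⌊R⌋₊,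
      |I q r| ≤ x * (1 + Real.log x) / (r * q) + S := by
    intro q hq r hr
    rw [hI]
    exact abs_inner_le_trivial (mem_moduliH.1 hq).2 (mem_moduliH.1 hq).1.1
      (Finset.mem_Icc.1 hr).1 hx1 hy0 hyx hS0 hSx _ fun s => Finset.filter_subset _ _
  have hF1 := first_sum_le (B := B) (hdiv x (by linarith)) hItriv hx1 hL1 hR1 hRx hS0 hQ0 hQx
    hQSR
  rw [← hκ] at hF1
  -- combination: `t = (log x)^{-(A+κ)}`
  obtain ⟨t, ht_def⟩ : ∃ t : ℝ, t = Real.log x ^ (-(A + κ)) := ⟨_, rfl⟩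
  have ht : 0 < t := by rw [ht_def]; exact Real.rpow_pos_of_pos hL0 _
  have h1 : t * Real.log x ^ (κ : ℝ) = (Real.log x ^ A)⁻¹ := by
    rw [ht_def, ← Real.rpow_add hL0, ← Real.rpow_neg hL0.le]
    congr 1; ring
  have h2 : t * Real.log x ^ (2 * A + κ) = Real.log x ^ A := by
    rw [ht_def, ← Real.rpow_add hL0]
    congr 1; ring
  calc ∑ q ∈ moduliH h (x ^ ε₁), ∑ r ∈ Icc 1 ⌊R⌋₊, tauPow B r * |I q r|
      ≤ ∑ q ∈ moduliH h (x ^ ε₁), ∑ r ∈ Icc 1 ⌊R⌋₊,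
          (t / 2 * (tauPow B r ^ 2 * |I q r|) + 1 / (2 * t) * |I q r|) :=
        Finset.sum_le_sum fun q _ => Finset.sum_le_sum fun r _ => weight_split (abs_nonneg _) ht
    _ = t / 2 * ∑ q ∈ moduliH h (x ^ ε₁), ∑ r ∈ Icc 1 ⌊R⌋₊, tauPow B r ^ 2 * |I q r| +
          1 / (2 * t) * ∑ q ∈ moduliH h (x ^ ε₁), ∑ r ∈ Icc 1 ⌊R⌋₊, |I q r| := by
        simp only [Finset.sum_add_distrib, Finset.mul_sum]
    _ ≤ t / 2 * (5 * C₁ * x * Real.log x ^ κ) +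
          1 / (2 * t) * (2 * (CX * x / Real.log x ^ (2 * A + κ))) := by gcongr
    _ = (5 * C₁ / 2 + CX) * x / Real.log x ^ A := by
        rw [← Real.rpow_natCast]
        have e1 : t / 2 * (5 * C₁ * x * Real.log x ^ (κ : ℝ)) =
            5 * C₁ / 2 * x * (t * Real.log x ^ (κ : ℝ)) := by ring
        have e2 : 1 / (2 * t) * (2 * (CX * x / Real.log x ^ (2 * A + κ))) =
            CX * x / (t * Real.log x ^ (2 * A + κ)) := by
          field_simp
        rw [e1, e2, h1, h2]
        field_simp

end Summit.Parity.GeneralizedHardyLittlewood.Theorems.EngineToPairs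

end
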